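import Literature.NumberTheory.Automorphic.GL2RSLFactorExistence
import HarnessLib

/-!
# The `GL₂ × GL₁` Rankin–Selberg `L`-factor `L(s, π × χ)` against a character of `GL₁`
# (Jacquet–Langlands 1970, Thm. 2.18 (i)–(ii), Props. 3.5, 3.8 (i); Jacquet–Piatetski-Shapiro–
# Shalika 1983, Thm. 2.7 (i)–(ii) for `(n, m) = (2, 1)`)

Topic `Literature/NumberTheory/Automorphic`; proof file (theorems only: no definition, no named
fact, no instance).  Continuation of `GL2RSLFactorExistence` (existence of `L(s, π × 1)`) and
`GL2LFactorTwistVanishing` (vanishing of `L(s, (π ⊗ χ∘det) × 1)` under ramified / deep twists).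

Let `F` be a non-archimedean local field, `π` a smooth representation of `GL₂(F)` on `V` with
finite-dimensional Jacquet module `V_N`, `ψ ≠ 1` a continuous additive character, `χ : Fˣ → ℂˣ` a
smooth character (open kernel) and `π' = glOneRep χ = χ ∘ det` the corresponding representation of
`GL₁(F)` on `ℂ`.  The Jacquet–Piatetski-Shapiro–Shalika zeta integrals of `π × χ` are the
Jacquet–Langlands Mellin transforms `Ψ(s; W, χ) = ∫_{Fˣ} W(d(a,1)) χ(a) |a|^{s-1/2} d^×a` (up to
`a ↦ a⁻¹`), and `L(s, π × χ)` in the sense of `HasRSLFactor` is the Jacquet–Langlands factor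
`L(s, χ ⊗ π)` of LNM 114, Thm. 2.18.  We PROVE:

* `whittakerFunctionals_twist_det`, `whittakerModel_twist_det`, `rsZeta_glOneRep_eq_rsZeta_twist`,
  `hasRSLFactor_glOneRep_iff_twist` — **`Ψ(s; W, χ) = Ψ(s; χ(det ·) W, 1)`**: twisting by
  `χ ∘ det` does not change the Whittaker functionals, multiplies Whittaker functions by `χ ∘ det`,
  and `HasRSLFactor (1<2) π (glOneRep χ) ψ ν P ↔ HasRSLFactor (1<2) (π ⊗ χ∘det) 1 ψ ν P`
  (Jacquet–Langlands 1970, p. 40 / Thm. 2.18: `L(s, χ ⊗ π)` is computed from `χ(a) W(d(a,1))`).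
* `exists_hasRSLFactor_trivial_natDegree_le`, `exists_hasRSLFactor_glOneRep`,
  `existsUnique_hasRSLFactor_glOneRep`, `exists_hasRSLFactor_glOneRep_smoothIrrep` — **existence
  and uniqueness of `L(s, π × χ) = 1/P(q^{-s})`, `P(0) = 1`, `deg P ≤ dim V_N (≤ 2)`**, for `π`
  smooth `ψ`-generic with finite-dimensional Jacquet module (resp. irreducible smooth generic),
  `χ` smooth and EVERY `GL₁(F)`-invariant Borel measure `ν` on `GL₁(F) ⧸ U₁` finite on compacts
  and positive on opens (Jacquet–Langlands 1970, Thm. 2.18 (i)–(ii) for `χ ⊗ π`; JPSS 1983,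
  Thm. 2.7 (i)–(ii)) — from `existsUnique_hasRSLFactor_fin_two_one` applied to the twist, which is
  smooth, `ψ`-generic and has the same Jacquet module (`restrictUnipotentGL_twist_det`), and the
  pole bound `natDegree_le_finrank_of_hasRSLFactor'`.
* `hasRSLFactor_glOneRep_eq_one_of_spherical`, `exists_unitFiltration_forall_hasRSLFactor_glOneRep_eq_one`
  — **`L(s, π × χ) = 1` for `π` spherical irreducible and `χ` ramified** (Jacquet–Langlands 1970,
  Prop. 3.5) **and for `χ` of conductor exponent `> N_π`** (Prop. 3.8 (i)), now for EVERY invariant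
  Radon full-support `ν` and in the `π × χ` form (`hasRSLFactor_twist_eq_one_of_spherical`,
  `exists_unitFiltration_forall_hasRSLFactor_twist_eq_one` + measure independence
  `hasRSLFactor_iff_of_smulInvariant`).
* `existsUnique_hasRSLFactor_haar_two_one_trivial`, `existsUnique_hasRSLFactor_haar_two_one_glOneRep`
  — the **literal `(2, 1)`-instances of the named fact `existsUnique_hasRSLFactor_haar`** of
  `RankinSelbergLocal` (JPSS 1983, Thm. 2.7 (i)–(ii)) for `π'` trivial and `π' = glOneRep χ`
  (representations on `V : Type`; `V_N` is finite-dimensional for irreducible smooth `π` by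
  `finiteDimensional_coinvariants_smoothIrrep_fin_two`).

These are the local inputs "`L π u` is the JPSS polynomial of `π_u × ω_u`", "`deg ≤ 2`",
"`P_u = 1` under ramified / deep twists" of the standard `L`-function theory of cuspidal `GL₂`
(`JacquetLanglands1970_twistedHeckeTheoryGL2`), in the `GL₂ × GL₁`-with-character form in which
that statement consumes them.

## References

* H. Jacquet, R. P. Langlands, *Automorphic forms on GL(2)*, LNM 114 (1970), Thm. 2.18 (i)–(ii)
  and p. 40 (`L(s, χ ⊗ π)`), Prop. 3.5, Prop. 3.8 (i). [JacquetLanglands1970]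
* H. Jacquet, I. I. Piatetski-Shapiro, J. Shalika, *Rankin–Selberg convolutions*, Amer. J. Math.
  105 (1983), §2.4, Thm. 2.7 (i)–(ii). [JacquetPiatetskiShapiroShalika1983]
* J. W. Cogdell, *Analytic theory of `L`-functions for `GL_n`* (2004), §3.1, Thm. 3.1.
  [CogdellAnalyticTheory2004]
-/

noncomputable section

open scoped MatrixGroups NNReal
open MeasureTheory ValuativeRel Polynomial Filter
  Literature.NumberTheory.GaloisRepresentations.IsNonarchimedeanLocalField

namespace Literature.NumberTheory.Automorphic

/-! ### Part 1: `Ψ(s; W, χ) = Ψ(s; χ(det ·) W, 1)` -/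

section Character

variable {F : Type*} [Field F] [ValuativeRel F] [TopologicalSpace F] [IsNonarchimedeanLocalField F]
  {V : Type*} [AddCommGroup V] [Module ℂ V] (π : Representation ℂ (GL (Fin 2) F) V)

omit [ValuativeRel F] [TopologicalSpace F] [IsNonarchimedeanLocalField F] in
/-- Twisting by `χ ∘ det` does not change the Whittaker functionals (`det = 1` on `N`). [folklore] -/
theorem whittakerFunctionals_twist_det (χ : Fˣ →* ℂˣ) (c : GL (Fin 2) F →* ℂˣ)
    (hc : ∀ g, c g = χ (Matrix.GeneralLinearGroup.det g)) (ψ : AddChar F Circle) :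
    whittakerFunctionals (π.twist c) ψ = whittakerFunctionals π ψ := by
  have hu : ∀ u : ↥(upperUnitriangular (Fin 2) F), (π.twist c) (u : GL (Fin 2) F) = π u := fun u => by
    refine LinearMap.ext fun v => ?_
    rw [Representation.twist_apply, hc, det_eq_one_of_mem_upperUnitriangular u.2, map_one,
      Units.val_one, one_smul]
  ext Λ
  simp only [mem_whittakerFunctionals_iff, hu]

omit [ValuativeRel F] [TopologicalSpace F] [IsNonarchimedeanLocalField F] in
/-- Whittaker functions of the twist: `W^{π ⊗ (χ∘det)}_v(g) = χ(det g) W^π_v(g)`. [folklore] -/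
theorem whittakerModel_twist_det (χ : Fˣ →* ℂˣ) (c : GL (Fin 2) F →* ℂˣ)
    (hc : ∀ g, c g = χ (Matrix.GeneralLinearGroup.det g)) (Λ : Module.Dual ℂ V) (v : V)
    (g : GL (Fin 2) F) :
    whittakerModel (π.twist c) Λ v g =
      ((χ (Matrix.GeneralLinearGroup.det g) : ℂˣ) : ℂ) * whittakerModel π Λ v g := by
  rw [whittakerModel_apply, whittakerModel_apply, Representation.twist_apply, hc, map_smul,
    smul_eq_mul]

variable [MeasurableSpace (GL (Fin 1) F ⧸ upperUnitriangular (Fin 1) F)]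

/-- **`Ψ(s; W, χ) = Ψ(s; W ⊗ χ, 1)`**: the `GL₂ × GL₁` zeta integral of `W = W_v ∈ 𝒲(π, ψ)`
against the Whittaker function `χ(det ·) Λ'(v')` of `glOneRep χ` is the zeta integral of the
Whittaker function `χ(det ·) W` of the twist `π ⊗ (χ ∘ det)` against the constant `Λ'(v')`
(Jacquet–Langlands 1970, p. 40 / Thm. 2.18: `L(s, χ ⊗ π)` is computed from the functions
`χ(a) W(d(a,1))`). [cite: JacquetLanglands1970, Thm. 2.18] -/
theorem rsZeta_glOneRep_eq_rsZeta_twist (ν : Measure (GL (Fin 1) F ⧸ upperUnitriangular (Fin 1) F))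
    {χ : Fˣ →* ℂˣ} {c : GL (Fin 2) F →* ℂˣ} (hc : ∀ g, c g = χ (Matrix.GeneralLinearGroup.det g))
    (Λ : Module.Dual ℂ V) (v : V) (Λ' : Module.Dual ℂ ℂ) (v' : ℂ) :
    rsZeta Nat.one_lt_two ν (whittakerModel π Λ v) (whittakerModel (glOneRep χ) Λ' v') =
      rsZeta Nat.one_lt_two ν (whittakerModel (π.twist c) Λ v)
        (whittakerModel (Representation.trivial ℂ (GL (Fin 1) F) ℂ) Λ' v') := by
  funext s
  have hint : rsIntegrand Nat.one_lt_two (whittakerModel π Λ v) (whittakerModel (glOneRep χ) Λ' v') s =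
      rsIntegrand Nat.one_lt_two (whittakerModel (π.twist c) Λ v)
        (whittakerModel (Representation.trivial ℂ (GL (Fin 1) F) ℂ) Λ' v') s := by
    funext g
    rw [rsIntegrand_whittakerModel_glOneRep, rsIntegrand, whittakerModel_twist_det π χ c hc,
      whittakerModel_trivial_apply, glCorner_one_eq_diagGL2, det_diagGL2_one_eq]
    simp only [map_inv, Units.val_inv_eq_inv_val]
    ring
  have hker : rsKernel Nat.one_lt_two (whittakerModel π Λ v) (whittakerModel (glOneRep χ) Λ' v') s =
      rsKernel Nat.one_lt_two (whittakerModel (π.twist c) Λ v)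
        (whittakerModel (Representation.trivial ℂ (GL (Fin 1) F) ℂ) Λ' v') s := by
    funext x
    induction x using QuotientGroup.induction_on with
    | H g => rw [rsKernel_mk_of_fin_one, rsKernel_mk_of_fin_one, hint]
  rw [rsZeta, rsZeta, hker]

/-- **`HasRSLFactor` for `π × χ` is `HasRSLFactor` for `(π ⊗ χ∘det) × 1`** (same fractional ideal
of zeta integrals, `rsZeta_glOneRep_eq_rsZeta_twist`; all linear forms on `ℂ` are Whittaker
functionals of a representation of `GL₁`). [cite: JacquetLanglands1970, Thm. 2.18] -/
theorem hasRSLFactor_glOneRep_iff_twist (ν : Measure (GL (Fin 1) F ⧸ upperUnitriangular (Fin 1) F))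
    {χ : Fˣ →* ℂˣ} {c : GL (Fin 2) F →* ℂˣ} (hc : ∀ g, c g = χ (Matrix.GeneralLinearGroup.det g))
    (ψ : AddChar F Circle) (P : ℂ[X]) :
    HasRSLFactor Nat.one_lt_two π (glOneRep χ) ψ ν P ↔
      HasRSLFactor Nat.one_lt_two (π.twist c) (Representation.trivial ℂ (GL (Fin 1) F) ℂ) ψ ν P := by
  simp only [HasRSLFactor, whittakerFunctionals_twist_det π χ c hc, whittakerFunctionals_eq_top_of_fin_one,
    rsZeta_glOneRep_eq_rsZeta_twist π ν hc]

variable [MeasurableSpace F] [BorelSpace F] [BorelSpace (GL (Fin 1) F ⧸ upperUnitriangular (Fin 1) F)]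

/-! ### Part 2: existence of `L(s, π × 1)` with the degree bound, and of `L(s, π × χ)` -/

/-- **`L(s, π × 1)` exists, `deg ≤ dim V_N`** (Jacquet–Langlands 1970, Thm. 2.18 (i)–(ii) with
Prop. 2.10; JPSS 1983, Thm. 2.7 (i)–(ii) for `(2, 1)`): for `π` smooth `ψ`-generic with
finite-dimensional Jacquet module and `ν` invariant Radon of full support there is `P`,
`P(0) = 1`, with `HasRSLFactor (1<2) π 1 ψ ν P` (`existsUnique_hasRSLFactor_fin_two_one`) and
`deg P ≤ dim V_N` (pole bound `natDegree_le_finrank_of_hasRSLFactor'` for `H = d(𝒪ˣ, 1)`,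
`dim (image of V^H) ≤ dim V_N`). [cite: JacquetLanglands1970, Thm. 2.18 (i)–(ii), Prop. 2.10] -/
theorem exists_hasRSLFactor_trivial_natDegree_le (hπ : π.IsSmooth) {ψ : AddChar F Circle}
    (hψ : ψ.IsContinuousNontrivial) (hg : IsGeneric π ψ)
    [FiniteDimensional ℂ (Representation.restrictUnipotentGL F (id : Fin 2 → Fin 2) π).Coinvariants]
    (ν : Measure (GL (Fin 1) F ⧸ upperUnitriangular (Fin 1) F))
    [SMulInvariantMeasure (GL (Fin 1) F) (GL (Fin 1) F ⧸ upperUnitriangular (Fin 1) F) ν]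
    [IsFiniteMeasureOnCompacts ν] [ν.IsOpenPosMeasure] :
    ∃ P : ℂ[X], HasRSLFactor Nat.one_lt_two π (Representation.trivial ℂ (GL (Fin 1) F) ℂ) ψ ν P ∧
      P.natDegree ≤ Module.finrank ℂ
        (Representation.restrictUnipotentGL F (id : Fin 2 → Fin 2) π).Coinvariants := by
  obtain ⟨Λ, hΛ, hΛ0⟩ := (isGeneric_iff π ψ).1 hg
  obtain ⟨P, hP, -⟩ := existsUnique_hasRSLFactor_fin_two_one π hπ hψ hΛ hΛ0 ν
  obtain ⟨H, hH⟩ := exists_subgroup_diagGL2_units (F := F)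
  exact ⟨P, hP, (natDegree_le_finrank_of_hasRSLFactor' π hπ hψ H hH ν hP).trans
    (Submodule.finrank_le _)⟩


/-- **Existence of `L(s, π × χ)` for a smooth character `χ` of `GL₁(F) = Fˣ`** (Jacquet–Langlands
1970, Thm. 2.18 (i)–(ii) for `χ ⊗ π`; Jacquet–Piatetski-Shapiro–Shalika 1983, Thm. 2.7 (i)–(ii) for
`(n, m) = (2, 1)`, `π' = χ ∘ det = glOneRep χ`): for `π` smooth `ψ`-generic with finite-dimensional
Jacquet module, `χ` with open kernel and `ν` invariant Radon of full support there is `P`,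
`P(0) = 1`, `deg P ≤ dim V_N`, with `HasRSLFactor (1<2) π (glOneRep χ) ψ ν P` (apply
`exists_hasRSLFactor_trivial_natDegree_le` to the twist `π ⊗ (χ ∘ det)`, which is smooth, `ψ`-generic and has the
same Jacquet module). [cite: JacquetLanglands1970, Thm. 2.18 (i)–(ii)]
[cite: JacquetPiatetskiShapiroShalika1983, Thm. 2.7 (i)–(ii)] -/
theorem exists_hasRSLFactor_glOneRep (hπ : π.IsSmooth) {ψ : AddChar F Circle}
    (hψ : ψ.IsContinuousNontrivial) (hg : IsGeneric π ψ)
    [FiniteDimensional ℂ (Representation.restrictUnipotentGL F (id : Fin 2 → Fin 2) π).Coinvariants]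
    {χ : Fˣ →* ℂˣ} (hχ : IsOpen (χ.ker : Set Fˣ))
    (ν : Measure (GL (Fin 1) F ⧸ upperUnitriangular (Fin 1) F))
    [SMulInvariantMeasure (GL (Fin 1) F) (GL (Fin 1) F ⧸ upperUnitriangular (Fin 1) F) ν]
    [IsFiniteMeasureOnCompacts ν] [ν.IsOpenPosMeasure] :
    ∃ P : ℂ[X], HasRSLFactor Nat.one_lt_two π (glOneRep χ) ψ ν P ∧
      P.natDegree ≤ Module.finrank ℂ
        (Representation.restrictUnipotentGL F (id : Fin 2 → Fin 2) π).Coinvariants := by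
  haveI : T2Space F :=
    (Literature.NumberTheory.GaloisRepresentations.IsNonarchimedeanLocalField.isLocalField F).toT2Space
  set c : GL (Fin 2) F →* ℂˣ := χ.comp Matrix.GeneralLinearGroup.det with hc_def
  have hc : ∀ g, c g = χ (Matrix.GeneralLinearGroup.det g) := fun g => rfl
  have hπ' : (π.twist c).IsSmooth := hπ.twist (isOpen_ker_of_det hχ hc)
  have hg' : IsGeneric (π.twist c) ψ := by
    rw [IsGeneric, whittakerFunctionals_twist_det π χ c hc]
    exact hg
  have hJ := restrictUnipotentGL_twist_det π χ c hc
  haveI : FiniteDimensional ℂ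
      (Representation.restrictUnipotentGL F (id : Fin 2 → Fin 2) (π.twist c)).Coinvariants := by
    rw [hJ]
    infer_instance
  obtain ⟨P, hP, hdeg⟩ := exists_hasRSLFactor_trivial_natDegree_le (π.twist c) hπ' hψ hg' ν
  refine ⟨P, (hasRSLFactor_glOneRep_iff_twist π ν hc ψ P).2 hP, ?_⟩
  rw [hJ] at hdeg
  exact hdeg

/-- **`∃! L(s, π × χ)`** (`(2, 1)`-instance of `existsUnique_hasRSLFactor_haar` for `π' = glOneRep χ`,
`χ` smooth; Jacquet–Piatetski-Shapiro–Shalika 1983, Thm. 2.7 (i)–(ii)).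
[cite: JacquetPiatetskiShapiroShalika1983, Thm. 2.7 (i)–(ii)] -/
theorem existsUnique_hasRSLFactor_glOneRep (hπ : π.IsSmooth) {ψ : AddChar F Circle}
    (hψ : ψ.IsContinuousNontrivial) (hg : IsGeneric π ψ)
    [FiniteDimensional ℂ (Representation.restrictUnipotentGL F (id : Fin 2 → Fin 2) π).Coinvariants]
    {χ : Fˣ →* ℂˣ} (hχ : IsOpen (χ.ker : Set Fˣ))
    (ν : Measure (GL (Fin 1) F ⧸ upperUnitriangular (Fin 1) F))
    [SMulInvariantMeasure (GL (Fin 1) F) (GL (Fin 1) F ⧸ upperUnitriangular (Fin 1) F) ν]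
    [IsFiniteMeasureOnCompacts ν] [ν.IsOpenPosMeasure] :
    ∃! P : ℂ[X], HasRSLFactor Nat.one_lt_two π (glOneRep χ) ψ ν P := by
  obtain ⟨P, hP, -⟩ := exists_hasRSLFactor_glOneRep π hπ hψ hg hχ ν
  exact HasRSLFactor.existsUnique_of_exists ⟨P, hP⟩

/-- **`L(s, π × χ)` exists and has degree `≤ 2`** for `π` irreducible smooth generic and `χ` a
smooth character (Jacquet–Langlands 1970, Thm. 2.18 (i)–(ii), Props. 3.5–3.6).
[cite: JacquetLanglands1970, Thm. 2.18 (i)–(ii)] -/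
theorem exists_hasRSLFactor_glOneRep_smoothIrrep (πv : SmoothIrrep (GL (Fin 2) F))
    {ψ : AddChar F Circle} (hψ : ψ.IsContinuousNontrivial) (hg : IsGeneric πv.ρ ψ)
    {χ : Fˣ →* ℂˣ} (hχ : IsOpen (χ.ker : Set Fˣ))
    (ν : Measure (GL (Fin 1) F ⧸ upperUnitriangular (Fin 1) F))
    [SMulInvariantMeasure (GL (Fin 1) F) (GL (Fin 1) F ⧸ upperUnitriangular (Fin 1) F) ν]
    [IsFiniteMeasureOnCompacts ν] [ν.IsOpenPosMeasure] :
    ∃ P : ℂ[X], HasRSLFactor Nat.one_lt_two πv.ρ (glOneRep χ) ψ ν P ∧ P.natDegree ≤ 2 := by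
  obtain ⟨hfd, hle⟩ := finiteDimensional_coinvariants_smoothIrrep_fin_two πv
  haveI := hfd
  obtain ⟨P, hP, hdeg⟩ := exists_hasRSLFactor_glOneRep πv.ρ πv.isSmooth hψ hg hχ ν
  exact ⟨P, hP, hdeg.trans hle⟩

end Character


/-! ### Part 3: `L(s, π × χ) = 1` under ramified and deep twists, for every invariant measure -/

section Vanishing

variable {F : Type*} [Field F] [ValuativeRel F] [TopologicalSpace F] [IsNonarchimedeanLocalField F]
  {V : Type*} [AddCommGroup V] [Module ℂ V] (π : Representation ℂ (GL (Fin 2) F) V)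
  [MeasurableSpace F] [BorelSpace F]
  [MeasurableSpace (GL (Fin 1) F ⧸ upperUnitriangular (Fin 1) F)]
  [BorelSpace (GL (Fin 1) F ⧸ upperUnitriangular (Fin 1) F)]

/-- **`L(s, π × χ) = 1` for `π` spherical irreducible and `χ` ramified** (Jacquet–Langlands 1970,
Prop. 3.5: `L(s, χ ⊗ π(μ₁, μ₂)) = L(s, χμ₁) L(s, χμ₂) = 1` for `μᵢ` unramified, `χ` ramified; and
Prop. 3.6 / Lemma 3.9 for the one-dimensional `π(μ₁, μ₂)`), in the `GL₂ × GL₁`-with-character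
form and for EVERY invariant Radon full-support `ν`: `π` smooth irreducible with
finite-dimensional Jacquet module and a non-zero `GL₂(𝒪)`-fixed vector, `χ` smooth and
non-trivial on `𝒪ˣ`; then every `P` with `HasRSLFactor (1<2) π (glOneRep χ) ψ ν P` is `1`
(`hasRSLFactor_twist_eq_one_of_spherical` + `hasRSLFactor_iff_of_smulInvariant` +
`hasRSLFactor_glOneRep_iff_twist`). [cite: JacquetLanglands1970, Prop. 3.5, Prop. 3.6] -/
theorem hasRSLFactor_glOneRep_eq_one_of_spherical [π.IsIrreducible] (hπ : π.IsSmooth)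
    {ψ : AddChar F Circle} (hψ : ψ.IsContinuousNontrivial)
    [FiniteDimensional ℂ (Representation.restrictUnipotentGL F (id : Fin 2 → Fin 2) π).Coinvariants]
    (hsph : ∃ v₀ : V, v₀ ≠ 0 ∧ v₀ ∈ π.fixedPoints (glInt 2 F))
    {χ : Fˣ →* ℂˣ} (hχ : IsOpen (χ.ker : Set Fˣ))
    (hram : ∃ u : Fˣ, valuation F (u : F) = 1 ∧ χ u ≠ 1)
    (ν : Measure (GL (Fin 1) F ⧸ upperUnitriangular (Fin 1) F))
    [SMulInvariantMeasure (GL (Fin 1) F) (GL (Fin 1) F ⧸ upperUnitriangular (Fin 1) F) ν]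
    [IsFiniteMeasureOnCompacts ν] [ν.IsOpenPosMeasure]
    {P : ℂ[X]} (hP : HasRSLFactor Nat.one_lt_two π (glOneRep χ) ψ ν P) : P = 1 := by
  set c : GL (Fin 2) F →* ℂˣ := χ.comp Matrix.GeneralLinearGroup.det with hc_def
  have hc : ∀ g, c g = χ (Matrix.GeneralLinearGroup.det g) := fun g => rfl
  obtain ⟨ν₀, hinv, hfin, hpos, h1⟩ := hasRSLFactor_twist_eq_one_of_spherical π hπ hψ hsph hχ hram hc
  haveI := hinv; haveI := hfin; haveI := hpos
  have hP' := (hasRSLFactor_glOneRep_iff_twist π ν hc ψ P).1 hP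
  exact h1 P ((hasRSLFactor_iff_of_smulInvariant Nat.one_lt_two (π.twist c) _ ψ ν ν₀ P).1 hP')

/-- **Deep twists kill `L(s, π × χ)`** (Jacquet–Langlands 1970, Prop. 3.8 (i): "if the order of
`χ` is large enough, `L(s, χ ⊗ π) = 1`"), in the `GL₂ × GL₁`-with-character form and for EVERY
invariant Radon full-support `ν`: for `π` smooth with finite-dimensional Jacquet module and `ψ`
continuous non-trivial there is `N ≥ 1` such that for every smooth `χ` non-trivial on
`U^N = 1 + 𝔭^N`, every `P` with `HasRSLFactor (1<2) π (glOneRep χ) ψ ν P` is `1`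
(`exists_unitFiltration_forall_hasRSLFactor_twist_eq_one` + measure independence + the twist
bridge). [cite: JacquetLanglands1970, Prop. 3.8 (i)] -/
theorem exists_unitFiltration_forall_hasRSLFactor_glOneRep_eq_one (hπ : π.IsSmooth)
    {ψ : AddChar F Circle} (hψ : ψ.IsContinuousNontrivial)
    [FiniteDimensional ℂ (Representation.restrictUnipotentGL F (id : Fin 2 → Fin 2) π).Coinvariants] :
    ∃ N : ℕ, 1 ≤ N ∧ ∀ (χ : Fˣ →* ℂˣ), IsOpen (χ.ker : Set Fˣ) →
      (∃ u ∈ unitFiltration F N, χ u ≠ 1) →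
      ∀ (ν : Measure (GL (Fin 1) F ⧸ upperUnitriangular (Fin 1) F))
        [SMulInvariantMeasure (GL (Fin 1) F) (GL (Fin 1) F ⧸ upperUnitriangular (Fin 1) F) ν]
        [IsFiniteMeasureOnCompacts ν] [ν.IsOpenPosMeasure]
        (P : ℂ[X]), HasRSLFactor Nat.one_lt_two π (glOneRep χ) ψ ν P → P = 1 := by
  obtain ⟨N, hN1, hN⟩ := exists_unitFiltration_forall_hasRSLFactor_twist_eq_one π hπ hψ
  refine ⟨N, hN1, fun χ hχ hdeep ν _ _ _ P hP => ?_⟩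
  set c : GL (Fin 2) F →* ℂˣ := χ.comp Matrix.GeneralLinearGroup.det with hc_def
  have hc : ∀ g, c g = χ (Matrix.GeneralLinearGroup.det g) := fun g => rfl
  obtain ⟨ν₀, hinv, hfin, hpos, h1⟩ := hN χ hχ hdeep c hc
  haveI := hinv; haveI := hfin; haveI := hpos
  have hP' := (hasRSLFactor_glOneRep_iff_twist π ν hc ψ P).1 hP
  exact h1 P ((hasRSLFactor_iff_of_smulInvariant Nat.one_lt_two (π.twist c) _ ψ ν ν₀ P).1 hP')

end Vanishing

/-! ### Part 4: the `(2, 1)`-instances of the named fact `existsUnique_hasRSLFactor_haar` -/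

section NamedFact

variable {F : Type*} [Field F] [ValuativeRel F] [TopologicalSpace F] [IsNonarchimedeanLocalField F]
  {V : Type} [AddCommGroup V] [Module ℂ V] (π : Representation ℂ (GL (Fin 2) F) V)
  [MeasurableSpace F] [BorelSpace F]
  [MeasurableSpace (GL (Fin 1) F ⧸ upperUnitriangular (Fin 1) F)]
  [BorelSpace (GL (Fin 1) F ⧸ upperUnitriangular (Fin 1) F)]

/-- **Jacquet–Piatetski-Shapiro–Shalika 1983, Thm. 2.7 (i)–(ii) for `GL₂ × GL₁`, `π'` trivial**:
the instance `(n, m) = (2, 1)`, `π' = 1`, of the named fact `existsUnique_hasRSLFactor_haar` of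
`RankinSelbergLocal` — for `π` irreducible admissible `ψ`-generic on `V : Type`, `ψ` continuous
non-trivial and `ν` invariant Radon of full support, `∃! P, HasRSLFactor (1<2) π 1 ψ ν P`
(`V_N` is finite-dimensional by `finiteDimensional_coinvariants_smoothIrrep_fin_two`).
[cite: JacquetPiatetskiShapiroShalika1983, Thm. 2.7 (i)–(ii)] [cite: JacquetLanglands1970, Thm. 2.18 (i)–(ii)] -/
theorem existsUnique_hasRSLFactor_haar_two_one_trivial (ψ : AddChar F Circle)
    (ν : Measure (GL (Fin 1) F ⧸ upperUnitriangular (Fin 1) F))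
    [SMulInvariantMeasure (GL (Fin 1) F) (GL (Fin 1) F ⧸ upperUnitriangular (Fin 1) F) ν]
    [IsFiniteMeasureOnCompacts ν] [ν.IsOpenPosMeasure] :
    existsUnique_hasRSLFactor_haar Nat.one_lt_two π (Representation.trivial ℂ (GL (Fin 1) F) ℂ) ψ ν := by
  intro hirr _ hπ _ hg _ hψ
  let πv : SmoothIrrep (GL (Fin 2) F) :=
    { V := V, ρ := π, isIrreducible := hirr, isSmooth := hπ.isSmooth }
  haveI := (finiteDimensional_coinvariants_smoothIrrep_fin_two πv).1
  obtain ⟨Λ, hΛ, hΛ0⟩ := (isGeneric_iff π ψ).1 hg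
  exact existsUnique_hasRSLFactor_fin_two_one π hπ.isSmooth hψ hΛ hΛ0 ν

/-- **Jacquet–Piatetski-Shapiro–Shalika 1983, Thm. 2.7 (i)–(ii) for `GL₂ × GL₁`, `π' = χ ∘ det`**:
the instance `(n, m) = (2, 1)`, `π' = glOneRep χ` (`χ` a smooth character of `Fˣ`), of the named
fact `existsUnique_hasRSLFactor_haar` — for `π` irreducible admissible `ψ`-generic on `V : Type`,
`∃! P, HasRSLFactor (1<2) π (glOneRep χ) ψ ν P`, i.e. `∃! L(s, π × χ)` (Jacquet–Langlands 1970,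
Thm. 2.18 (i)–(ii) for `χ ⊗ π`). [cite: JacquetPiatetskiShapiroShalika1983, Thm. 2.7 (i)–(ii)]
[cite: JacquetLanglands1970, Thm. 2.18 (i)–(ii)] -/
theorem existsUnique_hasRSLFactor_haar_two_one_glOneRep {χ : Fˣ →* ℂˣ}
    (hχ : IsOpen (χ.ker : Set Fˣ)) (ψ : AddChar F Circle)
    (ν : Measure (GL (Fin 1) F ⧸ upperUnitriangular (Fin 1) F))
    [SMulInvariantMeasure (GL (Fin 1) F) (GL (Fin 1) F ⧸ upperUnitriangular (Fin 1) F) ν]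
    [IsFiniteMeasureOnCompacts ν] [ν.IsOpenPosMeasure] :
    existsUnique_hasRSLFactor_haar Nat.one_lt_two π (glOneRep χ) ψ ν := by
  intro hirr _ hπ _ hg _ hψ
  let πv : SmoothIrrep (GL (Fin 2) F) :=
    { V := V, ρ := π, isIrreducible := hirr, isSmooth := hπ.isSmooth }
  haveI := (finiteDimensional_coinvariants_smoothIrrep_fin_two πv).1
  exact existsUnique_hasRSLFactor_glOneRep π hπ.isSmooth hψ hg hχ ν

end NamedFact

end Literature.NumberTheory.Automorphic

end
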